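import Mathlib
import HarnessLib
import Summits.HubbardSuperconductivity.HubbardSuperconductivity.Theses.WeakCouplingBCS
import Summits.HubbardSuperconductivity.HubbardSuperconductivity.Theorems.WeakCouplingBCSH1TwoPointLimitKLScaleDPlumbing
import Summits.HubbardSuperconductivity.HubbardSuperconductivity.Theorems.WeakCouplingBCSWcbcsKohnLuttingerB1gFormAWindowD010D025

/-!
# Route `WeakCouplingBCS` — rung R2d: the LOADED PAIR on the EXTENDED common doping window `δ ∈ [0.10, 0.25]`
# (leaf `H1TwoPointLimitKLScaleD` ∩ the certificate half with the window-extension record `klCertB1gWinZ`)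

Cell `gate-hubbard-kl`, seat `hubbard-kl-h1-p1` gen 2 (row «R2dH1 leaf → WeakCouplingBCS/H3 consumers»; LADDER-Hubbard §0 (D):
«the rung converts on the LOADED PAIR»; risk-register item r2 = the window).  Companion of
`…Theorems.WeakCouplingBCSH1TwoPointLimitKLScaleDPlumbing` (§3, the pair by name and on `μ`-windows) and of
`…Theorems.WeakCouplingBCSH1TwoPointLimitKLOnsetBridge` (seat h1-p2: the pair in the doping variable on the window of record
`[0.10, 0.20]`, `klPair_doping_d010_d020`).

The certificate half now reaches `δ ≈ 0.25`: the window-extension record `klCertB1gWinZ` (29 `μ`-uniform boxes on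
`[-0.5725, -0.42749]`, seat cert-2) together with the records `klCertB1gWin{A,B,C}` gives, in the packaging of seat cert-3
(`klb1g_formA_r2d_certificate_d010_d025`, with the UNCONDITIONAL `μ(δ) ∈ [-0.5725, -0.1775]` for `δ ∈ [0.10, 0.25]`,
`muOfDoping_mem_window_d010_d025`): for every `δ ∈ [0.10, 0.25]`, `B1g` leads every other `D₄` channel of the second-order
Kohn–Luttinger vertex at `μ(δ)` by `γ_Z U²`, `γ_Z = 16905/1048576`, for all `U ∈ (0,1)`, AND the `B1g` bottom is certified attractive,
`channelInf ε₀ μ(δ) U B1g ≤ -(1/12)·U²`.  The theorem half `H1TwoPointLimitKLScaleD` lives on `δ ∈ [0.10, 0.35]`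
(`R2dH1.control_subwindow`).  Hence the loaded pair on the COMMON window `[0.10, 0.25] = [0.10, 0.35] ∩ [0.05…, 0.25]`
(`klPair_doping_d010_d025`; packaged with one `(U₀, c, γ)` as `klPair_doping_d010_d025'`).  The pair cannot be stated below
`δ = 0.10`, the leaf's edge, whatever the certificate side adds there (record `klCertB1gWinD`): `[0.10, 0.25]` is the maximal common
window for the leaf of record.  Folklore glue, items consumed BY NAME, modulo the four named enclosure hypotheses (cert form (A));
no definitions.  Sources: S. Raghu, S. A. Kivelson, D. J. Scalapino, Phys. Rev. B 81 (2010) 224505, §III Fig. 2; G. Benfatto,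
A. Giuliani, V. Mastropietro, Ann. Henri Poincaré 7 (2006) 809, Thm 1.1.
-/

noncomputable section

-- the tree's namespace `Summit.<Summit>.<Problem>.Theorems` repeats the summit name by design (D-0017)
set_option linter.dupNamespace false

namespace Summit.HubbardSuperconductivity.HubbardSuperconductivity.Theorems.R2dH1

open Filter Set
open Literature.MathematicalPhysics.QuantumLattice Literature.Probability.LatticeModels
open Summit.HubbardSuperconductivity.HubbardSuperconductivity.Theses.WeakCouplingBCS (H1TwoPointLimitKLScaleD)
open scoped Topology

/-- **The leaf on the extended certificate window `δ ∈ [0.10, 0.25]`** (`⊆ [0.10, 0.35]`, same constants). [folklore] -/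
theorem control_extWindow (h : H1TwoPointLimitKLScaleD) :
    ∃ U₀ c : ℝ, 0 < U₀ ∧ 0 < c ∧ ∀ δ ∈ Set.Icc (0.10 : ℝ) 0.25, ∀ U β : ℝ, 0 < U → U ≤ U₀ → 0 < β →
      β ≤ Real.exp (c / U ^ 2) → ∀ (x y : Site 2) (σ σ' : Fin 2), ∃ S : ℂ,
        Tendsto (fun L : ℕ => hubbardThermalTwoPoint β U
          (chemicalPotentialOfDensity (squareDispersion 1 0) (1 - δ)) L x y σ σ') atTop (𝓝 S) :=
  control_subwindow h le_rfl (by norm_num)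

/-- **THE LOADED PAIR of rung R2d on the EXTENDED common window `δ ∈ [0.10, 0.25]`, explicit certificate constants.**  From the
four window enclosure records (`klCertB1gWinZ` + `klCertB1gWin{A,B,C}`, cert form (A)) and the leaf `H1TwoPointLimitKLScaleD`:
there are `U₀, c > 0` such that for every `δ ∈ [0.10, 0.25]`, at the free-band chemical potential `μ(δ)`:
(selection) `channelInf ε₀ μ(δ) U B1g + (16905/1048576)·U² ≤ channelInf ε₀ μ(δ) U χ` for all `U ∈ (0,1)` and every `χ ≠ B1g`;
(attraction) `channelInf ε₀ μ(δ) U B1g ≤ -(1/12)·U²` for every `U`; (control) the thermal two-point functions of the Hubbard torus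
at `μ(δ)` converge as `L → ∞` for all `0 < U ≤ U₀`, `0 < β ≤ e^{c/U²}`. [cite: RaghuKivelsonScalapino2010, §III Fig. 2] -/
theorem klPair_doping_d010_d025 (hZ : klCertB1gWinZ.EnclosuresB1g) (hA : klCertB1gWinA.EnclosuresB1g)
    (hB : klCertB1gWinB.EnclosuresB1g) (hC : klCertB1gWinC.EnclosuresB1g) (h : H1TwoPointLimitKLScaleD) :
    ∃ U₀ c : ℝ, 0 < U₀ ∧ 0 < c ∧ ∀ δ ∈ Set.Icc (0.10 : ℝ) 0.25,
      (∀ U ∈ Set.Ioo (0 : ℝ) 1, ∀ χ : D4Irrep, χ ≠ D4Irrep.B1g →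
        channelInf (squareDispersion 1 0) (chemicalPotentialOfDensity (squareDispersion 1 0) (1 - δ)) U D4Irrep.B1g +
            (16905 / 1048576 : ℝ) * U ^ 2 ≤
          channelInf (squareDispersion 1 0) (chemicalPotentialOfDensity (squareDispersion 1 0) (1 - δ)) U χ) ∧
      (∀ U : ℝ, channelInf (squareDispersion 1 0) (chemicalPotentialOfDensity (squareDispersion 1 0) (1 - δ)) U
          D4Irrep.B1g ≤ -(1 / 12 : ℝ) * U ^ 2) ∧
      (∀ U β : ℝ, 0 < U → U ≤ U₀ → 0 < β → β ≤ Real.exp (c / U ^ 2) →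
        ∀ (x y : Site 2) (σ σ' : Fin 2), ∃ S : ℂ,
          Tendsto (fun L : ℕ => hubbardThermalTwoPoint β U
            (chemicalPotentialOfDensity (squareDispersion 1 0) (1 - δ)) L x y σ σ') atTop (𝓝 S)) := by
  obtain ⟨U₀, c, hU₀, hc, H⟩ := control_extWindow h
  have hcert := klb1g_formA_r2d_certificate_d010_d025 hZ hA hB hC
  exact ⟨U₀, c, hU₀, hc, fun δ hδ => ⟨(hcert δ hδ).1, (hcert δ hδ).2, H δ hδ⟩⟩

/-- **The loaded pair on `[0.10, 0.25]`, packaged with ONE set of constants `(U₀, c, γ)`** (the shape of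
`R2dH1.klPair_doping_d010_d020` on the window of record; here `γ = 16905/1048576` and `U₀ ≤ 1`). [cite: RaghuKivelsonScalapino2010, §III Fig. 2] -/
theorem klPair_doping_d010_d025' (hZ : klCertB1gWinZ.EnclosuresB1g) (hA : klCertB1gWinA.EnclosuresB1g)
    (hB : klCertB1gWinB.EnclosuresB1g) (hC : klCertB1gWinC.EnclosuresB1g) (h : H1TwoPointLimitKLScaleD) :
    ∃ U₀ c γ : ℝ, 0 < U₀ ∧ 0 < c ∧ 0 < γ ∧ ∀ δ ∈ Set.Icc (0.10 : ℝ) 0.25,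
      (∀ U ∈ Set.Ioo (0 : ℝ) U₀, ∀ χ : D4Irrep, χ ≠ D4Irrep.B1g →
        channelInf (squareDispersion 1 0) (chemicalPotentialOfDensity (squareDispersion 1 0) (1 - δ)) U D4Irrep.B1g +
            γ * U ^ 2 ≤
          channelInf (squareDispersion 1 0) (chemicalPotentialOfDensity (squareDispersion 1 0) (1 - δ)) U χ) ∧
      (∀ U β : ℝ, 0 < U → U ≤ U₀ → 0 < β → β ≤ Real.exp (c / U ^ 2) →
        ∀ (x y : Site 2) (σ σ' : Fin 2), ∃ S : ℂ,
          Tendsto (fun L : ℕ => hubbardThermalTwoPoint β U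
            (chemicalPotentialOfDensity (squareDispersion 1 0) (1 - δ)) L x y σ σ') atTop (𝓝 S)) := by
  obtain ⟨U₀, c, hU₀, hc, H⟩ := klPair_doping_d010_d025 hZ hA hB hC h
  refine ⟨min U₀ 1, c, 16905 / 1048576, lt_min hU₀ one_pos, hc, by norm_num, fun δ hδ => ⟨?_, ?_⟩⟩
  · intro U hU χ hχ
    exact (H δ hδ).1 U ⟨hU.1, lt_of_lt_of_le hU.2 (min_le_right _ _)⟩ χ hχ
  · intro U β hU hUle
    exact (H δ hδ).2.2 U β hU (hUle.trans (min_le_left _ _))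

end Summit.HubbardSuperconductivity.HubbardSuperconductivity.Theorems.R2dH1

end
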